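import Mathlib
import HarnessLib
import Literature.Analysis.FluidPDE.CarlemanCalculus
import Summits.NavierStokesRegularity.NavierStokesRegularity.Theorems.RellichScarApexLocalisationTracelessConeLiouville
import Literature.Analysis.FluidPDE.ConeBackwardUniqueness

/-!
# Traceless cone Liouville theorem under Li–Šverák's cone backward uniqueness (line calm-cone-carleman, crux
# ApexLocalisation stmt-NavierStokesRegularity-11719, stub `stub_tracelessConeLiouvilleOfLiSverak` = S_L)

**Theorem (S_L).** Assume the backward uniqueness property across cones of opening `> 2 arccos(1/√3) ≈ 109.5°`
(Li–Šverák 2012, Thm. 1.1) in the `C¹₂` form `coneBackwardUniquenessC12` (a named literature fact, stated below as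
a `Prop` and kept as an explicit hypothesis).  Then for `0 ≤ κ < 1/√3` and a unit vector `e`, NO suitable weak
Navier–Stokes solution on the backward slab with a weak gradient, `𝐈 < ⊤` and the Type-I RATE `‖u(t,x)‖ ≤ C/√(−t)`
that is SCAR-FAINT on the cone `Γ_κ(e) = {x | κ‖x‖ < ⟪x,e⟫}` (`‖x‖‖u(t,x)‖ ≤ ε` for `x ∈ Γ`, `‖x‖ < δ(ε)`,
`−η(ε)‖x‖² < t < 0`) is singular at the space–time origin.

Proof: K1′ = `stub_tracelessConeLiouville` (same namespace, landed), whose (BU) hypothesis for the cone `Γ_κ(e)` is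
literally the named fact instantiated at `κ` and `e` (`κ < 1/√3 ≤ 1`).

References: Li–Šverák, CPDE 37 (2012) = arXiv:1011.2796, Thm. 1.1; Escauriaza–Seregin–Šverák 2003 (Thm. 1.4 scheme).
-/

noncomputable section

set_option linter.dupNamespace false

namespace Summit.NavierStokesRegularity.NavierStokesRegularity.Theorems.RellichScarApexLocalisation

open MeasureTheory Set Function Metric Filter Topology TopologicalSpace
open scoped ENNReal NNReal InnerProductSpace RealInnerProductSpace
open Literature.Analysis Literature.Analysis.FluidPDE

local notation "E³" => EuclideanSpace ℝ (Fin 3)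

/-- The open backward slab `(-∞, 0) × ℝ³` (time first). -/
local notation "𝕊" => Literature.Analysis.FluidPDE.slab (EuclideanSpace ℝ (Fin 3)) (Set.Iio (0 : ℝ)) isOpen_Iio

/-- `1/√3 ≤ 1`: the Li–Šverák aperture threshold lies inside K1′'s range `κ < 1`. [folklore] -/
theorem one_div_sqrt_three_le_one : 1 / Real.sqrt 3 ≤ (1 : ℝ) := by
  have h3 : (1 : ℝ) ≤ Real.sqrt 3 := Real.one_le_sqrt.mpr (by norm_num)
  rw [div_le_one (lt_of_lt_of_le one_pos h3)]
  exact h3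

/-- **S_L (stub_tracelessConeLiouvilleOfLiSverak).** Under `coneBackwardUniquenessC12`, for `0 ≤ κ < 1/√3`, a
suitable weak slab solution with a weak gradient, `𝐈 < ⊤` and the Type-I rate which is scar-faint on the cone
`{κ‖x‖ < ⟪x, e⟫}` is not singular at the origin (K1′ with its (BU) hypothesis supplied by the named fact).
[cite: LiSverak2012, Thm. 1.1] [cite: EscauriazaSereginSverak2003, Thm. 1.4 and §3] -/
theorem stub_tracelessConeLiouvilleOfLiSverak :
    Literature.Analysis.FluidPDE.coneBackwardUniquenessC12 → ∀ (κ : ℝ), 0 ≤ κ → κ < 1 / Real.sqrt 3 → ∀ (e : E³), ‖e‖ = 1 →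
      ∀ (C : ℝ) (u : ℝ → E³ → E³) (p : ℝ → E³ → ℝ) (G : ℝ → E³ → E³ →L[ℝ] E³),
      IsSuitableWeakSolutionOn 𝕊 1 0 u p → HasWeakSpatialGradientOn 𝕊 u G →
      typeIBound (Iio (0 : ℝ) ×ˢ univ) u p G < ⊤ → HasTypeITimeDecay C u →
      (∀ ε : ℝ, 0 < ε → ∃ δ : ℝ, 0 < δ ∧ ∃ η : ℝ, 0 < η ∧ ∀ x : E³, κ * ‖x‖ < ⟪x, e⟫ → ‖x‖ < δ →
        ∀ t : ℝ, -η * ‖x‖ ^ 2 < t → t < 0 → ‖x‖ * ‖u t x‖ ≤ ε) →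
      ¬ IsBackwardSingularPoint u 0 := by
  intro hBU κ hκ0 hκ1 e he C u p G hsw hwg hI hrate hfaint
  exact stub_tracelessConeLiouville κ hκ0 (lt_of_lt_of_le hκ1 one_div_sqrt_three_le_one) e he
    (hBU κ hκ0 hκ1 e he) C u p G hsw hwg hI hrate hfaint

end Summit.NavierStokesRegularity.NavierStokesRegularity.Theorems.RellichScarApexLocalisation
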